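import Mathlib.RingTheory.AdicCompletion.LocalRing
import Mathlib.RingTheory.AdicCompletion.RingHom
import Mathlib.RingTheory.Henselian
import HarnessLib

/-!
# The adic completion of a ring at a principal ideal: completeness, torsion, units,
# integrality, and the universal property for ring homomorphisms

Topic `RingTheory/AdicTopology` (proofs only; no definitions, no named facts). For a commutative
ring `R` and `a ∈ R` let `R̂ = AdicCompletion (a) R` (Mathlib) and `â` the image of `a`. We
collect the facts about `R̂` needed to work with the `p`-adic completion of a finitely generated
ring — the model case being Blakestad–Grant's `R̂ = p`-adic completion of `ℤ[1/6][A₄,A₆][1/H]`,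
the base of the universal ordinary Weierstrass curve (J. Number Theory 249 (2023), §2; tree: the
existence half of `WeierstrassCurve.mazur_tate_sigma_existsUnique`):

* `isAdicComplete_span` — `R̂` is `(â)`-adically complete (Mathlib's `isAdicComplete_self`,
  restated for the principal ideal `(â)` of `R̂` itself, the form in which the tree's `p`-adic
  files assume their base: `[IsAdicComplete (Ideal.span {(p : R)}) R]`);
* `factor_evalₐ`, `exists_sub_algebraMap_mem_pow` — every `x ∈ R̂` is `≡` an element of `R`
  modulo `âⁿ`;
* `eq_zero_of_algebraMap_mul_eq_zero`, `pow_mul_eq_zero_iff` — if `a` is a non-zero-divisor of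
  `R` then `â` is a non-zero-divisor of `R̂`;
* `isUnit_of_isUnit_mk`, `isUnit_iff_isUnit_mk` — units of a `J`-adically complete ring are
  the units modulo `J`;
* `span_algebraMap_isPrime`, `exists_eq_pow_mul_not_mem`, **`isDomain_of_isPrime`** — if `(a)` is
  a prime ideal of `R` and `a` is a non-zero-divisor, then `R̂` is an integral domain;
* `liftQuot`, **`lift`**, `lift_algebraMap`, **`ringHom_ext`**, `eq_lift` — the universal
  property: a ring map `φ : R → S` into a `J`-adically complete ring with `φ(a) ∈ J` extends
  uniquely to `R̂ → S` (for `a = p·1` and `J = (p)` the hypothesis is automatic);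
* `sub_pow_mem_span_of_forall_algebraMap` — a ring endomorphism `α` of `R̂` with
  `α(r) ≡ rᵖ (mod â)` for `r ∈ R` satisfies `α(x) ≡ xᵖ (mod â)` for all `x ∈ R̂` (Frobenius
  lifts are detected on `R`; Blakestad–Grant, Def. 8);
* the `p`-adic case `a = p·1` (`algebraMap_natCast`, `isAdicComplete_span_natCast`,
  `isDomain_natCast`, `liftNatCast`, `liftNatCast_algebraMap`, `eq_liftNatCast`), where the
  continuity hypotheses are automatic because every ring map fixes `p`.

Definitions introduced (with bodies): `liftQuot`, `lift`, `liftNatCast`. No named facts.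

## Sources

* Stacks Project, Tag 05GG (the completion is complete for finitely generated ideals; Mathlib
  `AdicCompletion.isAdicComplete`) and Tag 0ALJ (universal property); N. Bourbaki, *Algèbre
  commutative* III §2 no. 12–13 (separated completion; lifting of units and of homomorphisms)
  and III §2 no. 3 Prop. 5 / §5 (a filtered ring whose associated graded ring is a domain is a
  domain — here the elementary principal case). [folklore]
* C. Blakestad, D. Grant, J. Number Theory 249 (2023) §2.2 (the ring `R̂`, Def. 8, Thm. 15).
  [BlakestadGrant2023]
-/

noncomputable section

namespace Literature.RingTheory.AdicTopology

open AdicCompletion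

variable {R : Type*} [CommRing R] (a : R)

local notation3 "R̂" => AdicCompletion (Ideal.span {a}) R

/-! ### The ideal `(â)` and completeness -/

/-- `(a)·f = (f a)`. [folklore] -/
theorem map_span_singleton {S : Type*} [CommRing S] (f : R →+* S) :
    (Ideal.span {a}).map f = Ideal.span {f a} := by
  rw [Ideal.map_span, Set.image_singleton]

/-- `(a)^n = (a^n)`, membership form. [folklore] -/
theorem mem_span_singleton_pow_iff {S : Type*} [CommRing S] (b x : S) (n : ℕ) :
    x ∈ Ideal.span {b} ^ n ↔ ∃ z, x = b ^ n * z := by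
  rw [Ideal.span_singleton_pow, Ideal.mem_span_singleton]
  exact ⟨fun ⟨z, hz⟩ => ⟨z, hz⟩, fun ⟨z, hz⟩ => ⟨z, hz⟩⟩

/-- The image of `a` in `R̂` is `algebraMap R R̂ a = of a`. [folklore] -/
theorem algebraMap_eq_of (r : R) : algebraMap R R̂ r = of (Ideal.span {a}) R r := by
  rw [algebraMap_apply, Algebra.algebraMap_self, RingHom.id_apply]

/-- **`R̂` is `(â)`-adically complete.** (Mathlib: `AdicCompletion.isAdicComplete_self` for the
ideal `(a)R̂`; here `(a)R̂ = (â)`.) [folklore] -/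
theorem isAdicComplete_span : IsAdicComplete (Ideal.span {algebraMap R R̂ a}) R̂ := by
  rw [← map_span_singleton]
  exact isAdicComplete_self _ (Submodule.fg_span_singleton a)

/-- In particular `R̂` is `(â)`-adically separated. [folklore] -/
theorem isHausdorff_span : IsHausdorff (Ideal.span {algebraMap R R̂ a}) R̂ :=
  (isAdicComplete_span a).toIsHausdorff

/-! ### Reduction modulo `âⁿ` -/

/-- The reductions `R̂ → R ⧸ (a)ⁿ` are compatible. [folklore] -/
theorem factor_evalₐ {m n : ℕ} (hmn : m ≤ n) (x : R̂) :
    Ideal.Quotient.factor (Ideal.pow_le_pow_right hmn) (evalₐ (Ideal.span {a}) n x) =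
      evalₐ (Ideal.span {a}) m x := by
  obtain ⟨y, rfl⟩ := mk_surjective (Ideal.span {a}) R x
  rw [evalₐ_mk, evalₐ_mk, Ideal.Quotient.factor_mk]
  exact AdicCompletion.Ideal.mk_eq_mk _ hmn y

/-- The kernel of `R̂ → R ⧸ (a)ⁿ` is `(â)ⁿ`. [folklore] -/
theorem evalₐ_eq_zero_iff {n : ℕ} (x : R̂) :
    evalₐ (Ideal.span {a}) n x = 0 ↔ x ∈ Ideal.span {algebraMap R R̂ a} ^ n := by
  have hle : (Ideal.span {a} ^ n • ⊤ : Ideal R) ≤ Ideal.span {a} ^ n :=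
    le_of_eq (by rw [smul_eq_mul, Ideal.mul_top])
  have h1 : evalₐ (Ideal.span {a}) n x = 0 ↔ eval (Ideal.span {a}) R n x = 0 := by
    rw [← factor_eval_eq_evalₐ _ x hle]
    constructor
    · intro h
      have hinj : Function.Injective (Ideal.Quotient.factor hle) := by
        rw [RingHom.injective_iff_ker_eq_bot, Ideal.Quotient.factor_ker]  -- ker = map of I^n in R/(I^n•⊤)
        exact Ideal.map_mk_eq_bot_of_le (le_of_eq (by rw [smul_eq_mul, Ideal.mul_top]))
      exact hinj (h.trans (_root_.map_zero _).symm)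
    · intro h
      rw [h, _root_.map_zero]
  rw [h1, ← LinearMap.mem_ker, ← pow_smul_top_eq_ker_eval (Submodule.fg_span_singleton a),
    Ideal.smul_top_eq_map, Submodule.restrictScalars_mem, Ideal.map_pow, map_span_singleton]

/-- **Every element of `R̂` is congruent modulo `âⁿ` to an element of `R`.** [folklore] -/
theorem exists_sub_algebraMap_mem_pow (x : R̂) (n : ℕ) :
    ∃ r : R, x - algebraMap R R̂ r ∈ Ideal.span {algebraMap R R̂ a} ^ n := by
  obtain ⟨r, hr⟩ := Ideal.Quotient.mk_surjective (evalₐ (Ideal.span {a}) n x)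
  refine ⟨r, ?_⟩
  rw [← evalₐ_eq_zero_iff, map_sub, ← hr, algebraMap_eq_of, evalₐ_of, sub_self]

/-- `x ≡ r (mod âⁿ)` in terms of the reduction map: `evalₐ n x = r̄`. [folklore] -/
theorem evalₐ_eq_mk_iff {n : ℕ} (x : R̂) (r : R) :
    evalₐ (Ideal.span {a}) n x = Ideal.Quotient.mk _ r ↔
      x - algebraMap R R̂ r ∈ Ideal.span {algebraMap R R̂ a} ^ n := by
  rw [← evalₐ_eq_zero_iff, map_sub, algebraMap_eq_of, evalₐ_of, sub_eq_zero]

/-! ### Non-zero-divisors -/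

/-- **If `a` is a non-zero-divisor of `R`, then `â` is a non-zero-divisor of `R̂`**: if
`â x = 0` then, writing `x ≡ r (mod âⁿ⁺¹)`, `a r ∈ (a)ⁿ⁺¹`, so `r ∈ (a)ⁿ` and `x ≡ 0 (mod âⁿ)`
for every `n`. [folklore] -/
theorem eq_zero_of_algebraMap_mul_eq_zero (hreg : ∀ x : R, a * x = 0 → x = 0) {x : R̂}
    (hx : algebraMap R R̂ a * x = 0) : x = 0 := by
  refine ext_evalₐ fun n => ?_
  rw [_root_.map_zero]
  obtain ⟨r, hr⟩ := Ideal.Quotient.mk_surjective (evalₐ (Ideal.span {a}) (n + 1) x)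
  have h1 : Ideal.Quotient.mk (Ideal.span {a} ^ (n + 1)) (a * r) = 0 := by
    rw [_root_.map_mul, hr, ← evalₐ_of _ (n + 1) a, ← algebraMap_eq_of, ← _root_.map_mul, hx,
      _root_.map_zero]
  rw [Ideal.Quotient.eq_zero_iff_mem, mem_span_singleton_pow_iff] at h1
  obtain ⟨s, hs⟩ := h1
  have h2 : r = a ^ n * s := by
    have h3 : a * (r - a ^ n * s) = 0 := by rw [mul_sub, hs]; ring
    exact sub_eq_zero.mp (hreg _ h3)
  rw [← factor_evalₐ a (Nat.le_succ n), ← hr, Ideal.Quotient.factor_mk,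
    Ideal.Quotient.eq_zero_iff_mem, mem_span_singleton_pow_iff]
  exact ⟨s, h2⟩

/-- Iterating: `âⁿ x = 0 ↔ x = 0` for a non-zero-divisor `a`. [folklore] -/
theorem pow_mul_eq_zero_iff (hreg : ∀ x : R, a * x = 0 → x = 0) (n : ℕ) (x : R̂) :
    algebraMap R R̂ a ^ n * x = 0 ↔ x = 0 := by
  refine ⟨fun h => ?_, fun h => by rw [h, mul_zero]⟩
  induction n with
  | zero => simpa using h
  | succ n ih =>
    apply ih
    apply eq_zero_of_algebraMap_mul_eq_zero a hreg
    rw [← mul_assoc, ← pow_succ', h]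

/-! ### Units -/

/-- **Units lift along a complete ideal**: if `S` is `J`-adically complete and `x` is a unit
modulo `J`, then `x` is a unit (`J ⊆ Jac(S)`). [folklore] -/
theorem isUnit_of_isUnit_mk {S : Type*} [CommRing S] (J : Ideal S) [IsAdicComplete J S] {x : S}
    (h : IsUnit (Ideal.Quotient.mk J x)) : IsUnit x :=
  haveI := isLocalHom_of_le_jacobson_bot J (IsAdicComplete.le_jacobson_bot J)
  isUnit_of_map_unit (Ideal.Quotient.mk J) x h

/-- The units of a `J`-adically complete ring are exactly the units modulo `J`. [folklore] -/
theorem isUnit_iff_isUnit_mk {S : Type*} [CommRing S] (J : Ideal S) [IsAdicComplete J S] (x : S) :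
    IsUnit x ↔ IsUnit (Ideal.Quotient.mk J x) :=
  ⟨fun h => h.map _, isUnit_of_isUnit_mk J⟩

/-! ### Integrality -/

/-- The reduction `R̂ → R ⧸ (a)` modulo `â`: `R̂ ⧸ (â) ≅ R ⧸ (a)`; in particular **`(â)` is prime
when `(a)` is**. [folklore] -/
theorem span_algebraMap_isPrime [(Ideal.span {a}).IsPrime] :
    (Ideal.span {algebraMap R R̂ a}).IsPrime := by
  have hker : RingHom.ker (evalOneₐ (Ideal.span {a})).toRingHom = Ideal.span {algebraMap R R̂ a} := by
    rw [ker_evalOneₐ_eq_map _ (Submodule.fg_span_singleton a), map_span_singleton]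
  rw [← hker]
  exact RingHom.ker_isPrime _

/-- **Exact divisibility**: in `R̂` with `a` a non-zero-divisor of `R`, every `x ≠ 0` is `âⁿ · y`
with `y ∉ (â)` (`R̂` is `(â)`-adically separated). [folklore] -/
theorem exists_eq_pow_mul_not_mem {x : R̂} (hx : x ≠ 0) :
    ∃ (n : ℕ) (y : R̂), x = algebraMap R R̂ a ^ n * y ∧ y ∉ Ideal.span {algebraMap R R̂ a} := by
  classical
  haveI := isHausdorff_span a
  set b : R̂ := algebraMap R R̂ a with hb
  have hex : ∃ n, x ∉ Ideal.span {b} ^ n := by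
    by_contra hall
    refine hx (IsHausdorff.haus' (I := Ideal.span {b}) x fun n => ?_)
    rw [SModEq.zero, smul_eq_mul, Ideal.mul_top]
    exact not_not.mp (not_exists.mp hall n)
  set N := Nat.find hex with hNdef
  have hN : x ∉ Ideal.span {b} ^ N := Nat.find_spec hex
  have hN0 : N ≠ 0 := by
    intro h0
    rw [h0, pow_zero, Ideal.one_eq_top] at hN
    exact hN Submodule.mem_top
  obtain ⟨n, hn⟩ := Nat.exists_eq_succ_of_ne_zero hN0
  have hxn : x ∈ Ideal.span {b} ^ n := by
    have h := Nat.find_min hex (m := n) (by rw [← hNdef, hn]; exact Nat.lt_succ_self n)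
    exact not_not.mp h
  rw [mem_span_singleton_pow_iff] at hxn
  obtain ⟨y, hy⟩ := hxn
  refine ⟨n, y, hy, fun hymem => hN ?_⟩
  rw [Ideal.mem_span_singleton] at hymem
  obtain ⟨z, hz⟩ := hymem
  rw [hn, mem_span_singleton_pow_iff]
  exact ⟨z, by rw [hy, hz, pow_succ]; ring⟩

/-- **`R̂` is an integral domain when `(a)` is a prime ideal of `R` and `a` is a
non-zero-divisor** (e.g. `R = ℤ[A₄,A₆][1/H]`, `a = p`): write nonzero `x = âᵐx'`, `y = âᵏy'`
with `x', y' ∉ (â)`; if `xy = 0` then `x'y' = 0` (`â` is a non-zero-divisor), contradicting the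
primality of `(â)`. [folklore] -/
theorem isDomain_of_isPrime [(Ideal.span {a}).IsPrime] (hreg : ∀ x : R, a * x = 0 → x = 0) :
    IsDomain R̂ := by
  haveI hP := span_algebraMap_isPrime a
  haveI : Nontrivial R̂ :=
    ⟨⟨0, 1, fun h01 => hP.ne_top ((Ideal.eq_top_iff_one _).mpr (h01 ▸ Ideal.zero_mem _))⟩⟩
  haveI : NoZeroDivisors R̂ := ⟨fun {x y} hxy => by
    by_contra hne
    obtain ⟨hx0, hy0⟩ := not_or.mp hne
    obtain ⟨m, x', hx', hx'mem⟩ := exists_eq_pow_mul_not_mem a hx0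
    obtain ⟨k, y', hy', hy'mem⟩ := exists_eq_pow_mul_not_mem a hy0
    have h1 : algebraMap R R̂ a ^ (m + k) * (x' * y') = 0 := by
      rw [← hxy, hx', hy', pow_add]; ring
    rw [pow_mul_eq_zero_iff a hreg] at h1
    rcases hP.mem_or_mem (h1 ▸ Ideal.zero_mem _ : x' * y' ∈ Ideal.span {algebraMap R R̂ a}) with h | h
    · exact hx'mem h
    · exact hy'mem h⟩
  exact NoZeroDivisors.to_isDomain _

/-! ### The universal property for ring homomorphisms -/

section Lift

variable {S : Type*} [CommRing S]

/-- `(a)ⁿ ⊆ φ⁻¹(Jⁿ)` when `φ(a) ∈ J`. [folklore] -/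
theorem span_pow_le_comap_pow (J : Ideal S) (φ : R →+* S) (hφ : φ a ∈ J) (n : ℕ) :
    Ideal.span {a} ^ n ≤ (J ^ n).comap φ := by
  rw [Ideal.span_singleton_pow, Ideal.span_le, Set.singleton_subset_iff, SetLike.mem_coe,
    Ideal.mem_comap, map_pow]
  exact Ideal.pow_mem_pow hφ n

/-- The level-`n` maps `R̂ → R ⧸ (a)ⁿ → S ⧸ Jⁿ` induced by `φ`. [folklore] -/
def liftQuot (J : Ideal S) (φ : R →+* S) (hφ : φ a ∈ J) (n : ℕ) : R̂ →+* S ⧸ J ^ n :=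
  (Ideal.quotientMap (J ^ n) φ (span_pow_le_comap_pow a J φ hφ n)).comp
    (evalₐ (Ideal.span {a}) n).toRingHom

/-- `liftQuot n x = φ(r) mod Jⁿ` whenever `x ≡ r (mod âⁿ)`. [folklore] -/
theorem liftQuot_apply_of_evalₐ_eq (J : Ideal S) (φ : R →+* S) (hφ : φ a ∈ J) {n : ℕ} {x : R̂}
    {r : R} (h : evalₐ (Ideal.span {a}) n x = Ideal.Quotient.mk _ r) :
    liftQuot a J φ hφ n x = Ideal.Quotient.mk (J ^ n) (φ r) := by
  change Ideal.quotientMap (J ^ n) φ (span_pow_le_comap_pow a J φ hφ n)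
    (evalₐ (Ideal.span {a}) n x) = _
  rw [h, Ideal.quotientMap_mk]

/-- The level maps are compatible. [folklore] -/
theorem factorPow_comp_liftQuot (J : Ideal S) (φ : R →+* S) (hφ : φ a ∈ J) {m n : ℕ}
    (hmn : m ≤ n) :
    (Ideal.Quotient.factorPow J hmn).comp (liftQuot a J φ hφ n) = liftQuot a J φ hφ m := by
  refine RingHom.ext fun x => ?_
  obtain ⟨r, hr⟩ := Ideal.Quotient.mk_surjective (evalₐ (Ideal.span {a}) n x)
  have hm : evalₐ (Ideal.span {a}) m x = Ideal.Quotient.mk _ r := by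
    rw [← factor_evalₐ a hmn, ← hr, Ideal.Quotient.factor_mk]
  rw [RingHom.comp_apply, liftQuot_apply_of_evalₐ_eq a J φ hφ hr.symm,
    liftQuot_apply_of_evalₐ_eq a J φ hφ hm, Ideal.Quotient.factorPow, Ideal.Quotient.factor_mk]

/-- **The extension `R̂ → S` of `φ : R → S`** into a `J`-adically complete ring `S` with
`φ(a) ∈ J` (Mathlib's `IsAdicComplete.liftRingHom` applied to the level maps `liftQuot`).
[folklore] -/
def lift (J : Ideal S) [IsAdicComplete J S] (φ : R →+* S) (hφ : φ a ∈ J) : R̂ →+* S :=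
  IsAdicComplete.liftRingHom J (liftQuot a J φ hφ) (factorPow_comp_liftQuot a J φ hφ)

/-- `lift φ` modulo `Jⁿ` is the level-`n` map. [folklore] -/
theorem mk_lift_apply (J : Ideal S) [IsAdicComplete J S] (φ : R →+* S) (hφ : φ a ∈ J) (n : ℕ)
    (x : R̂) : Ideal.Quotient.mk (J ^ n) (lift a J φ hφ x) = liftQuot a J φ hφ n x :=
  IsAdicComplete.mk_liftRingHom J _ _ n x

/-- **`lift φ` extends `φ`**: `lift φ (r) = φ r` for `r ∈ R`. [folklore] -/
theorem lift_algebraMap (J : Ideal S) [IsAdicComplete J S] (φ : R →+* S) (hφ : φ a ∈ J) (r : R) :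
    lift a J φ hφ (algebraMap R R̂ r) = φ r := by
  refine (IsHausdorff.eq_iff_smodEq (I := J)).mpr fun n => ?_
  rw [SModEq.sub_mem, smul_eq_mul, Ideal.mul_top, ← Ideal.Quotient.eq, mk_lift_apply]
  exact liftQuot_apply_of_evalₐ_eq a J φ hφ (by rw [algebraMap_eq_of, evalₐ_of])

/-- `lift φ ∘ (R → R̂) = φ`. [folklore] -/
theorem lift_comp_algebraMap (J : Ideal S) [IsAdicComplete J S] (φ : R →+* S) (hφ : φ a ∈ J) :
    (lift a J φ hφ).comp (algebraMap R R̂) = φ :=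
  RingHom.ext (lift_algebraMap a J φ hφ)

end Lift

/-- **Uniqueness of extensions**: two ring maps `ψ, ψ' : R̂ → S` into a `J`-adically separated
ring that agree on `R` and send `â` into `J` are equal (every `x ∈ R̂` is `≡ r ∈ R (mod âⁿ)`,
so `ψ x ≡ ψ' x (mod Jⁿ)` for all `n`). [folklore] -/
theorem ringHom_ext {S : Type*} [CommRing S] (J : Ideal S) [IsHausdorff J S] {ψ ψ' : R̂ →+* S}
    (hJ : ψ (algebraMap R R̂ a) ∈ J) (h : ∀ r : R, ψ (algebraMap R R̂ r) = ψ' (algebraMap R R̂ r)) :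
    ψ = ψ' := by
  have hJ' : ψ' (algebraMap R R̂ a) ∈ J := h a ▸ hJ
  refine RingHom.ext fun x => (IsHausdorff.eq_iff_smodEq (I := J)).mpr fun n => ?_
  rw [SModEq.sub_mem, smul_eq_mul, Ideal.mul_top]
  obtain ⟨r, hr⟩ := exists_sub_algebraMap_mem_pow a x n
  rw [mem_span_singleton_pow_iff] at hr
  obtain ⟨z, hz⟩ := hr
  have hx : x = algebraMap R R̂ r + algebraMap R R̂ a ^ n * z := by rw [← hz]; ring
  have e : ψ x - ψ' x = ψ (algebraMap R R̂ a) ^ n * ψ z - ψ' (algebraMap R R̂ a) ^ n * ψ' z := by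
    rw [hx, map_add, map_add, map_mul, map_mul, map_pow, map_pow, h r]; ring
  rw [e]
  exact sub_mem (Ideal.mul_mem_right _ _ (Ideal.pow_mem_pow hJ n))
    (Ideal.mul_mem_right _ _ (Ideal.pow_mem_pow hJ' n))

/-- Hence **`lift φ` is the unique extension of `φ`** among maps sending `â` into `J`.
[folklore] -/
theorem eq_lift {S : Type*} [CommRing S] (J : Ideal S) [IsAdicComplete J S] (φ : R →+* S)
    (hφ : φ a ∈ J) {ψ : R̂ →+* S} (h : ∀ r : R, ψ (algebraMap R R̂ r) = φ r) :
    ψ = lift a J φ hφ :=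
  ringHom_ext a J (by rw [h a]; exact hφ) fun r => by rw [h r, lift_algebraMap a J φ hφ r]

/-- For `a = p · 1` (an integer) the continuity hypothesis is automatic: every ring map sends
`p̂` to `p`. So **ring maps out of the `p`-adic completion into a `p`-adically separated ring are
determined by their restriction to `R`.** [folklore] -/
theorem ringHom_ext_natCast {S : Type*} [CommRing S] (p : ℕ) [IsHausdorff (Ideal.span {(p : S)}) S]
    {ψ ψ' : AdicCompletion (Ideal.span {(p : R)}) R →+* S}
    (h : ∀ r : R, ψ (algebraMap R _ r) = ψ' (algebraMap R _ r)) : ψ = ψ' :=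
  ringHom_ext (p : R) (Ideal.span {(p : S)}) (by rw [map_natCast, map_natCast]; exact Ideal.mem_span_singleton_self _) h

/-! ### Frobenius lifts are detected on `R` -/

/-- **Frobenius congruences propagate from `R` to `R̂`.** Let `α` be a ring endomorphism of `R̂`
with `α(â) ∈ (â)` and `α(r) - rᵖ ∈ (â)` for all `r ∈ R` (images in `R̂`). Then
`α(x) - xᵖ ∈ (â)` for every `x ∈ R̂`: write `x = r + âz`; then `α x = α r + α(â)α(z)` and
`xᵖ - rᵖ` is a multiple of `âz`. (Blakestad–Grant, Def. 8: "`α` extends uniquely … to `R̂`, where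
it still reduces to the Frobenius mod `p`".) [folklore] -/
theorem sub_pow_mem_span_of_forall_algebraMap (p : ℕ) (α : R̂ →+* R̂)
    (hα : α (algebraMap R R̂ a) ∈ Ideal.span {algebraMap R R̂ a})
    (h : ∀ r : R, α (algebraMap R R̂ r) - algebraMap R R̂ r ^ p ∈ Ideal.span {algebraMap R R̂ a})
    (x : R̂) : α x - x ^ p ∈ Ideal.span {algebraMap R R̂ a} := by
  obtain ⟨r, hr⟩ := exists_sub_algebraMap_mem_pow a x 1
  rw [pow_one, Ideal.mem_span_singleton] at hr
  obtain ⟨z, hz⟩ := hr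
  have hx : x = algebraMap R R̂ r + algebraMap R R̂ a * z := by rw [← hz]; ring
  have hdvd : x - algebraMap R R̂ r ∣ x ^ p - algebraMap R R̂ r ^ p := sub_dvd_pow_sub_pow _ _ p
  rw [hz] at hdvd
  have e : α x - x ^ p = (α (algebraMap R R̂ r) - algebraMap R R̂ r ^ p) +
      α (algebraMap R R̂ a) * α z - (x ^ p - algebraMap R R̂ r ^ p) := by
    have hαx : α x = α (algebraMap R R̂ r) + α (algebraMap R R̂ a) * α z := by
      rw [hx, map_add, map_mul]
    rw [hαx]; ring
  rw [e]
  refine sub_mem (add_mem (h r) (Ideal.mul_mem_right _ _ hα)) ?_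
  exact Ideal.mem_span_singleton.mpr ((dvd_mul_right _ _).trans hdvd)


/-! ### The `p`-adic case `a = p · 1` -/

section NatCast

variable (R) (p : ℕ)

/-- The image of `p ∈ R` in the `p`-adic completion is `p`. [folklore] -/
theorem algebraMap_natCast :
    algebraMap R (AdicCompletion (Ideal.span {(p : R)}) R) (p : R) = p :=
  map_natCast _ p

/-- **The `p`-adic completion of `R` is `p`-adically complete** — the instance shape
`IsAdicComplete (Ideal.span {(p : ·)}) ·` assumed by the tree's `p`-adic files. [folklore] -/
theorem isAdicComplete_span_natCast :
    IsAdicComplete (Ideal.span {(p : AdicCompletion (Ideal.span {(p : R)}) R)})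
      (AdicCompletion (Ideal.span {(p : R)}) R) := by
  have h := isAdicComplete_span (p : R)
  rwa [algebraMap_natCast] at h

/-- The `p`-adic completion of `R` is a domain when `(p)` is a prime ideal of `R` and `R` has no
`p`-torsion. [folklore] -/
theorem isDomain_natCast [(Ideal.span {(p : R)}).IsPrime] (hreg : ∀ x : R, (p : R) * x = 0 → x = 0) :
    IsDomain (AdicCompletion (Ideal.span {(p : R)}) R) :=
  isDomain_of_isPrime (p : R) hreg

/-- `pᵏ x = 0 ↔ x = 0` in the `p`-adic completion of a ring without `p`-torsion. [folklore] -/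
theorem natCast_pow_mul_eq_zero_iff (hreg : ∀ x : R, (p : R) * x = 0 → x = 0) (k : ℕ)
    (x : AdicCompletion (Ideal.span {(p : R)}) R) : (p : _) ^ k * x = 0 ↔ x = 0 := by
  rw [← algebraMap_natCast R p]
  exact pow_mul_eq_zero_iff (p : R) hreg k x

variable {S : Type*} [CommRing S] [IsAdicComplete (Ideal.span {(p : S)}) S]

/-- **Specialisation / extension maps out of a `p`-adic completion**: any ring map `φ : R → S`
into a `p`-adically complete ring extends to the `p`-adic completion of `R` (no hypothesis:
`φ(p) = p`). (Blakestad–Grant, Def. 8 and Thm. 15: `α` and `ρ` "extend to a map on `R_H`, and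
then to a map on `R̂` since `A` is `p`-complete".) [folklore] -/
def liftNatCast (φ : R →+* S) : AdicCompletion (Ideal.span {(p : R)}) R →+* S :=
  lift (p : R) (Ideal.span {(p : S)}) φ (by rw [map_natCast]; exact Ideal.mem_span_singleton_self _)

/-- `liftNatCast φ` extends `φ`. [folklore] -/
theorem liftNatCast_algebraMap (φ : R →+* S) (r : R) :
    liftNatCast R p φ (algebraMap R _ r) = φ r :=
  lift_algebraMap (p : R) _ φ _ r

/-- `liftNatCast φ` is the unique extension of `φ`. [folklore] -/
theorem eq_liftNatCast (φ : R →+* S) {ψ : AdicCompletion (Ideal.span {(p : R)}) R →+* S}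
    (h : ∀ r : R, ψ (algebraMap R _ r) = φ r) : ψ = liftNatCast R p φ :=
  eq_lift (p : R) _ φ _ h

end NatCast

end Literature.RingTheory.AdicTopology
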